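import Summits.KontsevichZagierPeriods.KontsevichZagierPeriods.Theorems.SymplecticScissorsVolumeFormOffPlaneMatrixPowerMove

/-!
# Crux `VolumeFormOffPlane` (stmt-KontsevichZagierPeriods-14935) — line `Sketch`,
stub `stub_monomialCertificates` (certificates are transported along matrix power moves)

Box dimension `n`, total dimension `n + 1`. A CERTIFICATE for an integral representation `τ`
over the class of `Λ`-boxes (`Λ = ⟨α, β⟩`, boxes `∏ (a_ι, a_ι α^{u_ι} β^{v_ι})` with unit slack,
integrand `1`) is the datum `d ≠ 0`, boxes `σ_j`, weights `w_j ∈ ℤ` with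
`d • [τ] − Σ_j w_j • [σ_j] ∈ KZ.relations`.

For `M ∈ ℤ^{n×n}` with `det M ≠ 0` and two integrand-`1` representations `ρ`, `ρ'` inside the
open orthant whose membership is transported by the matrix power chart `Φ_M`, the landed matrix
power move (`stub_matrixPowerMove`, file `…MatrixPowerMove.lean`) gives
`[ρ'] − D • [ρ] ∈ KZ.relations`, `D = |det M| ≠ 0`. Hence certificates transport both ways by
pure bookkeeping in the abelian group `KZ.FormalRep`:
* pull-back: `(d D) • [ρ] − Σ w_j • [σ_j] = (d • [ρ'] − Σ w_j • [σ_j]) − d • ([ρ'] − D • [ρ])`;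
* push-forward: `d • [ρ'] − Σ (D w_j) • [σ_j] = d • ([ρ'] − D • [ρ]) + D • (d • [ρ] − Σ w_j • [σ_j])`.
The box class itself is never inspected, only transported.

Sources: M. Kontsevich, D. Zagier, *Periods* (2001), §1.2 (the calculus); the bookkeeping is
folklore.
-/

noncomputable section

open MeasureTheory Set
open Literature.NumberTheory.Transcendental

namespace Summit.KontsevichZagierPeriods.SymplecticScissors.LogPolytope

/-! ## Bookkeeping in an abelian group -/

/-- Pull-back of a certificate along a move `x' − D • x ∈ R`: a certificate `d • x' − S ∈ R`
for `x'` yields the certificate `(d D) • x − S ∈ R` for `x`. [folklore] -/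
theorem mcert_pull {A : Type*} [AddCommGroup A] (R : AddSubgroup A) {x x' S : A} {D d : ℕ}
    (h : x' - D • x ∈ R) (hc : d • x' - S ∈ R) : (d * D) • x - S ∈ R := by
  have key : (d * D) • x - S = (d • x' - S) - d • (x' - D • x) := by
    rw [nsmul_sub, ← mul_nsmul']
    abel
  rw [key]
  exact R.sub_mem hc (R.nsmul_mem h d)

/-- Push-forward of a certificate along a move `x' − D • x ∈ R`: a certificate
`d • x − Σ w_j • y_j ∈ R` for `x` yields the certificate `d • x' − Σ (D w_j) • y_j ∈ R` for `x'`.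
[folklore] -/
theorem mcert_push {A : Type*} [AddCommGroup A] (R : AddSubgroup A) {ι : Type*} [Fintype ι]
    {x x' : A} {y : ι → A} {w : ι → ℤ} {D d : ℕ}
    (h : x' - D • x ∈ R) (hc : d • x - ∑ j, w j • y j ∈ R) :
    d • x' - ∑ j, ((D : ℤ) * w j) • y j ∈ R := by
  have hsum : ∑ j, ((D : ℤ) * w j) • y j = D • ∑ j, w j • y j := by
    rw [Finset.smul_sum]
    exact Finset.sum_congr rfl fun j _ => by rw [mul_zsmul, natCast_zsmul]
  have key : d • x' - ∑ j, ((D : ℤ) * w j) • y j =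
      d • (x' - D • x) + D • (d • x - ∑ j, w j • y j) := by
    rw [hsum, nsmul_sub, nsmul_sub, ← mul_nsmul', ← mul_nsmul, sub_add_sub_cancel]
  rw [key]
  exact R.add_mem (R.nsmul_mem h d) (R.nsmul_mem hc D)

/-! ## The stub -/

/-- **Monomial certificates** (stub `stub_monomialCertificates` of `VolumeFormOffPlane`, line
`Sketch`, stmt-KontsevichZagierPeriods-14935). For `M : Matrix (Fin n) (Fin n) ℤ` with
`det M ≠ 0` and integrand-`1` representations `ρ`, `ρ'` in the open orthant whose membership is
transported by the matrix power chart `Φ_M`, certificates over the class of `Λ`-boxes pass from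
`ρ'` to `ρ` (denominator multiplied by `|det M|`) and from `ρ` to `ρ'` (weights multiplied by
`|det M|`), by the matrix power move `[ρ'] − |det M| • [ρ] ∈ KZ.relations`.
[Kontsevich–Zagier 2001, §1.2; folklore] -/
theorem stub_monomialCertificates : ∀ (n : ℕ) (α β : ℝ), 0 < α → 0 < β → IsAlgebraic ℚ α → IsAlgebraic ℚ β →
    ∀ (M : Matrix (Fin n) (Fin n) ℤ), M.det ≠ 0 → ∀ (ρ ρ' : KZ.IntegralRep (n + 1)),
    ρ.domain ⊆ {p | ∀ ι : Fin (n), 0 < p (Fin.castSucc ι)} →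
    ρ'.domain ⊆ {p | ∀ ι : Fin (n), 0 < p (Fin.castSucc ι)} →
    (∀ p : Fin (n + 1) → ℝ, (∀ ι : Fin n, 0 < p (Fin.castSucc ι)) → (p ∈ ρ.domain ↔ (Fin.snoc (fun k : Fin (n) => ∏ j : Fin (n), p (Fin.castSucc j) ^ (M k j)) (p (Fin.last (n)) * (∏ j : Fin (n), p (Fin.castSucc j)) / ∏ k : Fin (n), ∏ j : Fin (n), p (Fin.castSucc j) ^ (M k j)) : Fin ((n) + 1) → ℝ) ∈ ρ'.domain)) →
    (∀ p ∈ ρ.domain, ρ.integrand p = 1) → (∀ p ∈ ρ'.domain, ρ'.integrand p = 1) →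
    ((∃ (d l : ℕ) (σ : Fin l → KZ.IntegralRep (n + 1)) (w : Fin l → ℤ), d ≠ 0 ∧
      (∀ j, w j ≠ 0 → ∃ (a : Fin (n) → ℝ) (u v : Fin (n) → ℚ),
      (∀ ξ ∈ (σ j).domain, (σ j).integrand ξ = 1) ∧ (∀ ι, 0 < a ι) ∧
      (∀ ι, IsAlgebraic ℚ (a ι)) ∧ (∀ ι, 1 < α ^ ((u ι : ℚ) : ℝ) * β ^ ((v ι : ℚ) : ℝ)) ∧
      (σ j).domain = {ξ : Fin (n + 1) → ℝ | (∀ ι : Fin (n), a ι < ξ (Fin.castSucc ι) ∧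
      ξ (Fin.castSucc ι) < a ι * (α ^ ((u ι : ℚ) : ℝ) * β ^ ((v ι : ℚ) : ℝ))) ∧
      0 < ξ (Fin.last (n)) ∧ ξ (Fin.last (n)) * ∏ ι : Fin (n), ξ (Fin.castSucc ι) < 1}) ∧
      d • KZ.of ρ' - ∑ j, w j • KZ.of (σ j) ∈ KZ.relations) →
      ∃ (d l : ℕ) (σ : Fin l → KZ.IntegralRep (n + 1)) (w : Fin l → ℤ), d ≠ 0 ∧
        (∀ j, w j ≠ 0 → ∃ (a : Fin (n) → ℝ) (u v : Fin (n) → ℚ),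
          (∀ ξ ∈ (σ j).domain, (σ j).integrand ξ = 1) ∧ (∀ ι, 0 < a ι) ∧
          (∀ ι, IsAlgebraic ℚ (a ι)) ∧ (∀ ι, 1 < α ^ ((u ι : ℚ) : ℝ) * β ^ ((v ι : ℚ) : ℝ)) ∧
          (σ j).domain = {ξ : Fin (n + 1) → ℝ | (∀ ι : Fin (n), a ι < ξ (Fin.castSucc ι) ∧
            ξ (Fin.castSucc ι) < a ι * (α ^ ((u ι : ℚ) : ℝ) * β ^ ((v ι : ℚ) : ℝ))) ∧
            0 < ξ (Fin.last (n)) ∧ ξ (Fin.last (n)) * ∏ ι : Fin (n), ξ (Fin.castSucc ι) < 1}) ∧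
        d • KZ.of ρ - ∑ j, w j • KZ.of (σ j) ∈ KZ.relations) ∧
    ((∃ (d l : ℕ) (σ : Fin l → KZ.IntegralRep (n + 1)) (w : Fin l → ℤ), d ≠ 0 ∧
      (∀ j, w j ≠ 0 → ∃ (a : Fin (n) → ℝ) (u v : Fin (n) → ℚ),
      (∀ ξ ∈ (σ j).domain, (σ j).integrand ξ = 1) ∧ (∀ ι, 0 < a ι) ∧
      (∀ ι, IsAlgebraic ℚ (a ι)) ∧ (∀ ι, 1 < α ^ ((u ι : ℚ) : ℝ) * β ^ ((v ι : ℚ) : ℝ)) ∧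
      (σ j).domain = {ξ : Fin (n + 1) → ℝ | (∀ ι : Fin (n), a ι < ξ (Fin.castSucc ι) ∧
      ξ (Fin.castSucc ι) < a ι * (α ^ ((u ι : ℚ) : ℝ) * β ^ ((v ι : ℚ) : ℝ))) ∧
      0 < ξ (Fin.last (n)) ∧ ξ (Fin.last (n)) * ∏ ι : Fin (n), ξ (Fin.castSucc ι) < 1}) ∧
      d • KZ.of ρ - ∑ j, w j • KZ.of (σ j) ∈ KZ.relations) →
      ∃ (d l : ℕ) (σ : Fin l → KZ.IntegralRep (n + 1)) (w : Fin l → ℤ), d ≠ 0 ∧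
        (∀ j, w j ≠ 0 → ∃ (a : Fin (n) → ℝ) (u v : Fin (n) → ℚ),
          (∀ ξ ∈ (σ j).domain, (σ j).integrand ξ = 1) ∧ (∀ ι, 0 < a ι) ∧
          (∀ ι, IsAlgebraic ℚ (a ι)) ∧ (∀ ι, 1 < α ^ ((u ι : ℚ) : ℝ) * β ^ ((v ι : ℚ) : ℝ)) ∧
          (σ j).domain = {ξ : Fin (n + 1) → ℝ | (∀ ι : Fin (n), a ι < ξ (Fin.castSucc ι) ∧
            ξ (Fin.castSucc ι) < a ι * (α ^ ((u ι : ℚ) : ℝ) * β ^ ((v ι : ℚ) : ℝ))) ∧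
            0 < ξ (Fin.last (n)) ∧ ξ (Fin.last (n)) * ∏ ι : Fin (n), ξ (Fin.castSucc ι) < 1}) ∧
        d • KZ.of ρ' - ∑ j, w j • KZ.of (σ j) ∈ KZ.relations) := by
  intro n α β _ _ _ _ M hM ρ ρ' hρpos hρ'pos hiff hρ1 hρ'1
  have hrel : KZ.of ρ' - M.det.natAbs • KZ.of ρ ∈ KZ.relations :=
    (stub_matrixPowerMove n M hM).2 ρ ρ' hρpos hρ'pos hiff hρ1 hρ'1
  have hD : M.det.natAbs ≠ 0 := Int.natAbs_ne_zero.mpr hM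
  refine ⟨?_, ?_⟩
  · rintro ⟨d, l, σ, w, hd, hσ, hc⟩
    exact ⟨d * M.det.natAbs, l, σ, w, mul_ne_zero hd hD, hσ, mcert_pull KZ.relations hrel hc⟩
  · rintro ⟨d, l, σ, w, hd, hσ, hc⟩
    exact ⟨d, l, σ, fun j => (M.det.natAbs : ℤ) * w j, hd,
      fun j hj => hσ j (right_ne_zero_of_mul hj), mcert_push KZ.relations hrel hc⟩

end Summit.KontsevichZagierPeriods.SymplecticScissors.LogPolytope

end
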